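import Mathlib
import Summits.AtomisticToContinuum.HydrodynamicLimit.Theorems.ImplosionDichotomyDenseExcursionSonicCentreContentLevinson

/-!
# The bulk bootstrap of the weighted Levinson transport with the explicit envelopes of `CavityTubeBulk`
# (crux `DenseExcursion`, line `sonic-cavity-renewal` v7, brick for `stub_centreContent`)

Helper file (`--supports stmt-AtomisticToContinuum-12586`, line lead a2, stub-worker B for `stub_centreContent`).

The landed weighted Levinson lemmas (`levinson_weighted_sup`, `levinson_weighted_slow`, `…SonicCentreContentLevinson`)
bound the fast component `w` of a triangular-interaction system `u′ = α w`, `w′ = q w + β u` in the growth-normalised size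
`e^{𝔊 a − 𝔊 x}‖w x‖` and the slow component after one integration by parts. This file performs, ONCE AND FOR ALL NUMBERS,
the bootstrap that the bulk transport of the centre content consumes (`bulk_ratio_of_tubeB`, its own file): on an interval
`[a, b]` with `e^{−a} = 100`, `e^{−b} ≤ 219/100`, `e^{b} ≤ 1/2`, `b − a ≤ 4` (i.e. `a = log(1/100)`, `b = −7/10`), if

* the couplings obey the pointwise envelopes `‖β/q‖ ≤ e^{−x}/2000`, `‖(β/q)′‖ ≤ (13/25000)e^{−x}`,
  `‖β/q‖‖α‖, ‖α/q‖‖β‖ ≤ (53/100000)e^{−x}`, `‖(α/q)′‖eˣ ≤ 511/10⁶`, `‖α/q‖ ≤ (0.51e^{−x} + 0.61)/1000`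
  (what `CavityTubeBulk` delivers after division by `|Im Λ| > 1000`, file `…SonicCentreContentBulkAlgebra`),
* the growth majorant `𝔊` of `Re ∫ q` is dominated linearly, `𝔊 x − 𝔊 a ≤ x − a`, with total `e^{𝔊 b − 𝔊 a} ≤ 9`,
* and the inner standing wave holds at `a`: `‖w a‖ ≤ 2‖u a‖`,

then `‖w b‖ ≤ 80‖u b‖` (`levinson_bulk_bootstrap`, registered helper). Bookkeeping: with `U = sup ‖u‖`, the fast bootstrap
gives `V := sup e^{𝔊 a − 𝔊}‖w‖ ≤ (2 + 1/10 + 13/250)U/(1 − 53/1000)`; the slow estimate with the linear weight `e^{x − a}`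
gives `U ≤ ‖u b‖ + (9·17269/10⁷ + 815/10⁴ + 2044/10⁴)V + (53/1000)U`; hence `U ≤ 3.82‖u b‖` and
`‖w b‖ ≤ 9V ≤ 78.1‖u b‖`. Sources: Coppel 1965 Ch. IV; Eastham 1989 Thm 1.3.1 (no citation is load-bearing).
-/

noncomputable section

open Set

namespace Summit.AtomisticToContinuum.HydrodynamicLimit.Theorems.SonicCavityRenewal

/-- `y ↦ e^{−y}` has derivative `−e^{−x}`. [folklore] -/
theorem hasDerivAt_exp_neg' (x : ℝ) : HasDerivAt (fun y => Real.exp (-y)) (-Real.exp (-x)) x := by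
  simpa using (hasDerivAt_neg x).exp

/-- **THE BULK BOOTSTRAP** — registered helper `levinson_bulk_bootstrap` for `stub_centreContent`. For a triangular-interaction
system `u′ = α w`, `w′ = q w + β u` on `[a, b]` (`e^{−a} = 100`, `e^{−b} ≤ 219/100`, `e^{b} ≤ 1/2`, `b − a ≤ 4`) with a
primitive `Q` of `q ≠ 0`, a continuous growth majorant `𝔊` (`Re (Q x − Q y) ≤ 𝔊 x − 𝔊 y`, `𝔊 a ≤ 𝔊 x`, `𝔊 x − 𝔊 a ≤ x − a`,
`e^{𝔊 b − 𝔊 a} ≤ 9`), the coupling envelopes `‖β/q‖ ≤ e^{−x}/2000`, `‖(β/q)′‖ ≤ (13/25000)e^{−x}`,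
`‖β/q‖‖α‖ ≤ (53/10⁵)e^{−x}`, `‖(α/q)′‖eˣ ≤ 511/10⁶`, `‖α/q‖‖β‖ ≤ (53/10⁵)e^{−x}`, `‖α/q‖ ≤ (0.51e^{−x} + 0.61)/1000`,
and `‖w a‖ ≤ 2‖u a‖`: `‖w b‖ ≤ 80‖u b‖`. [folklore] -/
theorem levinson_bulk_bootstrap : ∀ (a b : ℝ) (u w α β q Q ρ' σ' : ℝ → ℂ) (𝔊 : ℝ → ℝ), a ≤ b → (∀ x ∈ Set.Icc a b, HasDerivAt u (α x * w x) x) → (∀ x ∈ Set.Icc a b, HasDerivAt w (q x * w x + β x * u x) x) → (∀ x ∈ Set.Icc a b, HasDerivAt Q (q x) x) → (∀ x ∈ Set.Icc a b, q x ≠ 0) → (∀ x ∈ Set.Icc a b, ∀ y ∈ Set.Icc a x, (Q x - Q y).re ≤ 𝔊 x - 𝔊 y) → (∀ x ∈ Set.Icc a b, 𝔊 a ≤ 𝔊 x) → ContinuousOn 𝔊 (Set.Icc a b) → (∀ x ∈ Set.Icc a b, 𝔊 x - 𝔊 a ≤ x - a) → Real.exp (𝔊 b - 𝔊 a) ≤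 9 → (∀ x ∈ Set.Icc a b, HasDerivAt (fun y => β y / q y) (ρ' x) x) → (∀ x ∈ Set.Icc a b, HasDerivAt (fun y => α y / q y) (σ' x) x) → (∀ x ∈ Set.Icc a b, ‖β x / q x‖ ≤ Real.exp (-x) / 2000) → (∀ x ∈ Set.Icc a b, ‖ρ' x‖ ≤ 13 / 25000 * Real.exp (-x)) → (∀ x ∈ Set.Icc a b, ‖β x / q x‖ * ‖α x‖ ≤ 53 / 100000 * Real.exp (-x)) → (∀ x ∈ Set.Icc a b, ‖σ' x‖ * Real.exp x ≤ 511 / 1000000) → (∀ x ∈ Set.Icc a b, ‖α x / q x‖ * ‖β x‖ ≤ 53 / 100000 * Real.exp (-x)) → (∀ x ∈ Set.Icc a b, ‖α x / q x‖ ≤ (51 / 100 * Real.exp (-x) + 61 / 100) / 1000) → Real.exp (-a) = 100 → Real.exp (-b) ≤ 219 / 100 → Real.exp b ≤ 1 / 2 → b - a ≤ 4 → ‖w a‖ ≤ 2 * ‖u a‖ → ‖w b‖ ≤ 80 * ‖u b‖ := by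
  intro a b u w α β q Q ρ' σ' 𝔊 hab hu hw hQ hq h𝔊 h𝔊a h𝔊c h𝔊lin h𝔊b hρ hσ hε₁ hφ₂ hφ₃ hψ₂ hψ₃ hαq ha hb1 hb2 hba hwa
  have haI : a ∈ Icc a b := left_mem_Icc.2 hab
  have hbI : b ∈ Icc a b := right_mem_Icc.2 hab
  have ha' : Real.exp a = 1 / 100 := by
    have h := ha
    rw [Real.exp_neg] at h
    rw [← inv_inv (Real.exp a), h, one_div]
  -- `e^{-x} ≤ 100` on `[a, b]`
  have hex : ∀ x ∈ Icc a b, Real.exp (-x) ≤ 100 := fun x hx => by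
    rw [← ha]; exact Real.exp_le_exp.2 (neg_le_neg hx.1)
  -- the majorant primitives
  set Φ₂ : ℝ → ℝ := fun y => -(13 / 25000) * Real.exp (-y) with hΦ₂
  set Φ₃ : ℝ → ℝ := fun y => -(53 / 100000) * Real.exp (-y) with hΦ₃
  have hΦ₂d : ∀ x ∈ Icc a b, HasDerivAt Φ₂ (13 / 25000 * Real.exp (-x)) x := fun x _ => by
    have h := (hasDerivAt_exp_neg' x).const_mul (-(13 / 25000 : ℝ))
    simp only [hΦ₂]
    exact h.congr_deriv (by ring)
  have hΦ₃d : ∀ x ∈ Icc a b, HasDerivAt Φ₃ (53 / 100000 * Real.exp (-x)) x := fun x _ => by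
    have h := (hasDerivAt_exp_neg' x).const_mul (-(53 / 100000 : ℝ))
    simp only [hΦ₃]
    exact h.congr_deriv (by ring)
  -- the sup of the slow component
  have hucont : ContinuousOn (fun x => ‖u x‖) (Icc a b) :=
    fun x hx => (hu x hx).continuousAt.continuousWithinAt.norm
  obtain ⟨y₀, hy₀, hmax⟩ := isCompact_Icc.exists_isMaxOn (nonempty_Icc.2 hab) hucont
  set U : ℝ := ‖u y₀‖ with hUdef
  have hU : ∀ x ∈ Icc a b, ‖u x‖ ≤ U := fun x hx => hmax hx
  have hU0 : 0 ≤ U := norm_nonneg _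
  -- THE FAST BOOTSTRAP
  have hsmall : Φ₃ b - Φ₃ a < 1 := by
    simp only [hΦ₃]; rw [ha]; have := Real.exp_pos (-b); nlinarith
  have hE₁ : ∀ x ∈ Icc a b, Real.exp (-x) / 2000 ≤ 1 / 20 := fun x hx => by
    have := hex x hx; linarith
  have hsup := levinson_weighted_sup (ε₁ := fun x => Real.exp (-x) / 2000) (E₁ := 1 / 20) (Φ₂ := Φ₂)
    (φ₂ := fun x => 13 / 25000 * Real.exp (-x)) (Φ₃ := Φ₃) (φ₃ := fun x => 53 / 100000 * Real.exp (-x)) (U := U)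
    hab hu hw hQ hρ hq h𝔊 h𝔊a h𝔊c hε₁ hE₁ hΦ₂d hφ₂ hΦ₃d hφ₃ hU hsmall
  set V : ℝ := (‖w a‖ + (2 * (1 / 20) + (Φ₂ b - Φ₂ a)) * U) / (1 - (Φ₃ b - Φ₃ a)) with hVdef
  have hV0 : 0 ≤ V := by
    have h := hsup a haI
    rw [sub_self, Real.exp_zero, one_mul] at h
    exact (norm_nonneg _).trans h
  have hwx : ∀ x ∈ Icc a b, ‖w x‖ ≤ Real.exp (𝔊 x - 𝔊 a) * V := by
    intro x hx
    have h1 : Real.exp (𝔊 a - 𝔊 x) * ‖w x‖ ≤ V := hsup x hx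
    have h2 : Real.exp (𝔊 x - 𝔊 a) * (Real.exp (𝔊 a - 𝔊 x) * ‖w x‖) = ‖w x‖ := by
      rw [← mul_assoc, ← Real.exp_add, show 𝔊 x - 𝔊 a + (𝔊 a - 𝔊 x) = 0 by ring, Real.exp_zero, one_mul]
    calc ‖w x‖ = Real.exp (𝔊 x - 𝔊 a) * (Real.exp (𝔊 a - 𝔊 x) * ‖w x‖) := h2.symm
      _ ≤ Real.exp (𝔊 x - 𝔊 a) * V := mul_le_mul_of_nonneg_left h1 (Real.exp_pos _).le
  have hV : ∀ x ∈ Icc a b, ‖w x‖ ≤ Real.exp (x - a) * V := fun x hx =>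
    (hwx x hx).trans (mul_le_mul_of_nonneg_right (Real.exp_le_exp.2 (h𝔊lin x hx)) hV0)
  have hwb : ‖w b‖ ≤ 9 * V := (hwx b hbI).trans (mul_le_mul_of_nonneg_right h𝔊b hV0)
  -- `V ≤ λ U`
  have hVU : 947 / 1000 * V ≤ 2152 / 1000 * U := by
    have hden : 0 < 1 - (Φ₃ b - Φ₃ a) := by linarith
    have e1 : V * (1 - (Φ₃ b - Φ₃ a)) = ‖w a‖ + (2 * (1 / 20) + (Φ₂ b - Φ₂ a)) * U := div_mul_cancel₀ _ hden.ne'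
    have hΔ₂ : Φ₂ b - Φ₂ a ≤ 13 / 250 := by
      simp only [hΦ₂]; rw [ha]; have := Real.exp_pos (-b); nlinarith
    have hΔ₃ : Φ₃ b - Φ₃ a ≤ 53 / 1000 := by
      simp only [hΦ₃]; rw [ha]; have := Real.exp_pos (-b); nlinarith
    have hua : ‖u a‖ ≤ U := hU a haI
    nlinarith
  -- THE SLOW ESTIMATE with the linear weight `e^{x - a}`
  have hψ₂' : ∀ x ∈ Icc a b, ‖σ' x‖ * Real.exp (x - a) ≤ 511 / 10000 := by
    intro x hx
    rw [Real.exp_sub, ha']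
    have := hψ₂ x hx
    have h0 : 0 ≤ ‖σ' x‖ * Real.exp x := by positivity
    rw [mul_div_assoc']
    rw [div_le_iff₀ (by norm_num : (0 : ℝ) < 1 / 100)]
    linarith
  have hslow := levinson_weighted_slow (a := a) (b := b) (𝔊 := fun y => y) (Ψ₂ := fun y => 511 / 10000 * y)
    (ψ₂ := fun _ => 511 / 10000) (Ψ₃ := Φ₃) (ψ₃ := fun x => 53 / 100000 * Real.exp (-x)) (V := V) hu hw hq hσ
    (fun x _ => by simpa using (hasDerivAt_id x).const_mul (511 / 10000 : ℝ)) hψ₂' hΦ₃d hψ₃ hU hV b hbI y₀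
    ⟨hy₀.1, hy₀.2⟩
  -- the boundary terms of the slow estimate
  have hHb : ‖α b / q b * w b‖ ≤ 17269 / 10000000 * (9 * V) := by
    rw [norm_mul]
    refine mul_le_mul ((hαq b hbI).trans ?_) hwb (norm_nonneg _) (by norm_num)
    linarith
  have hHy : ‖α y₀ / q y₀ * w y₀‖ ≤ 815 / 10000 * V := by
    rw [norm_mul]
    have hEy : Real.exp y₀ ≤ 1 / 2 := (Real.exp_le_exp.2 hy₀.2).trans hb2
    have hEy0 : 0 < Real.exp y₀ := Real.exp_pos _
    have hinv : Real.exp (-y₀) * Real.exp y₀ = 1 := by rw [← Real.exp_add, neg_add_cancel, Real.exp_zero]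
    calc ‖α y₀ / q y₀‖ * ‖w y₀‖
        ≤ (51 / 100 * Real.exp (-y₀) + 61 / 100) / 1000 * (Real.exp (y₀ - a) * V) :=
          mul_le_mul (hαq y₀ hy₀) (hV y₀ hy₀) (norm_nonneg _) (by positivity)
      _ = (51 + 61 * Real.exp y₀) / 1000 * V := by
          have hya : Real.exp (y₀ - a) = 100 * Real.exp y₀ := by rw [Real.exp_sub, ha']; ring
          rw [hya]
          linear_combination (51 / 1000 * V) * hinv
      _ ≤ 815 / 10000 * V := by
          apply mul_le_mul_of_nonneg_right _ hV0
          linarith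
  have hΨ₂ : (511 / 10000 * b - 511 / 10000 * y₀) * V ≤ 2044 / 10000 * V :=
    mul_le_mul_of_nonneg_right (by nlinarith [hy₀.1, hba]) hV0
  have hΨ₃ : (Φ₃ b - Φ₃ y₀) * U ≤ 53 / 1000 * U := by
    apply mul_le_mul_of_nonneg_right _ hU0
    simp only [hΦ₃]; have := hex y₀ hy₀; have := Real.exp_pos (-b); nlinarith
  -- triangle inequality for `U = ‖u y₀‖`
  set D : ℂ := (u b - α b / q b * w b) - (u y₀ - α y₀ / q y₀ * w y₀) with hD
  have hUle : U ≤ ‖u b‖ + ‖α b / q b * w b‖ + ‖D‖ + ‖α y₀ / q y₀ * w y₀‖ := by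
    have e : u y₀ = (u b - α b / q b * w b) - D + α y₀ / q y₀ * w y₀ := by simp only [hD]; ring
    calc U = ‖u y₀‖ := rfl
      _ = ‖(u b - α b / q b * w b) - D + α y₀ / q y₀ * w y₀‖ := by rw [← e]
      _ ≤ ‖(u b - α b / q b * w b) - D‖ + ‖α y₀ / q y₀ * w y₀‖ := norm_add_le _ _
      _ ≤ ‖u b - α b / q b * w b‖ + ‖D‖ + ‖α y₀ / q y₀ * w y₀‖ := by gcongr; exact norm_sub_le _ _
      _ ≤ ‖u b‖ + ‖α b / q b * w b‖ + ‖D‖ + ‖α y₀ / q y₀ * w y₀‖ := by gcongr; exact norm_sub_le _ _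
  have hDle : ‖D‖ ≤ (511 / 10000 * b - 511 / 10000 * y₀) * V + (Φ₃ b - Φ₃ y₀) * U := hslow
  -- conclusion
  have hP0 : 0 ≤ ‖u b‖ := norm_nonneg _
  nlinarith [hUle, hDle, hHb, hHy, hΨ₂, hΨ₃, hVU, hwb, hV0, hU0]

end Summit.AtomisticToContinuum.HydrodynamicLimit.Theorems.SonicCavityRenewal

end
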